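import Summits.ABC.IUTFork.LanaPadicGalois
import Mathlib.FieldTheory.RatFunc.AsPolynomial
import Mathlib.RingTheory.Localization.FractionRing
import Mathlib.Algebra.Ring.Action.End
import HarnessLib

/-!
# LANA §3.5 vocabulary row F-2630 `IsValPreserving` — ∀-closure REFUTED, instance INHABITED

PROOF-ONLY companion (0 `def`, 0 `instance`, 0 notation) of the abc-iut cell, block F (seat abc-iut-f-130, gen 7; director-abc g4
ROW SUPPLY `ROWS-LF-0348.tsv` «decide the label»). It imports — never edits — `LanaLocalUnits` (the hypothesis CLASS `IsValPreserving w G`: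
"`G` acts on `K` by ring automorphisms PRESERVING the valuation, `|g·a| = |a|`", LANA §3.5 p. 19) and `LanaPadicGalois` (the instance of
record `isValPreserving_padic` at `ℚ̄_p`).

The FACT-LIST row F-2630 is a vocabulary predicate over a FREE valued field with a FREE group action; its universal closure («every ring
action on every valued field preserves the valuation») is FALSE:

* `not_forall_isValPreserving` — over `K = ℚ(X)` (Mathlib `RatFunc ℚ`) with the `X`-adic valuation (`Polynomial.idealX`) and the
  tautological action of `RingAut ℚ(X)`, the substitution `X ↦ X + 1` (Mathlib `Polynomial.algEquivAevalXAddC 1`, transported to the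
  fraction field by `IsFractionRing.ringEquivOfRingEquiv`) sends `X` (valuation `< 1`) to `X + 1` (valuation `= 1`);
* `exists_isValPreserving` — `Gal(ℚ̄_p/ℚ_p) ↷ ℚ̄_p` preserves `| · |` (`isValPreserving_padic`, by name, at `p = 2`).

HONEST FRAMING: says only that the free SCHEMA is not a theorem; in the LANA report `G_v` is by definition a group of isometric automorphisms,
exactly what the instance of record proves at `ℚ_p`. No side taken on the report, on [IUTchIII] Cor. 3.12 or on any author; a FACT row is
an assumption label on OUR typed statement; typed ≠ proved. [cite: LANA2026Report, §3.5 p. 19]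
-/

noncomputable section

namespace Summit.ABC

namespace IUTFork

namespace SchemaClosures

open Polynomial IsDedekindDomain

/-- **F-2630, ∀-closure REFUTED**: the `X`-adic valuation of `ℚ(X)` is not preserved by the ring automorphism `X ↦ X + 1`
(`v_X(X) < 1 = v_X(X + 1)`). [cite: LANA2026Report, §3.5 p. 19] -/
theorem not_forall_isValPreserving :
    ¬ ∀ (K : Type) [Field K] (Γ₀ : Type) [LinearOrderedCommGroupWithZero Γ₀] (w : Valuation K Γ₀)
        (G : Type) [Group G] [MulSemiringAction G K], IsValPreserving w G := by
  intro h
  -- the X-adic valuation of ℚ(X) and the automorphism X ↦ X + 1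
  let v := (Polynomial.idealX ℚ).valuation (RatFunc ℚ)
  let σ : RingAut (RatFunc ℚ) :=
    IsFractionRing.ringEquivOfRingEquiv (K := RatFunc ℚ) (L := RatFunc ℚ) (algEquivAevalXAddC (1 : ℚ)).toRingEquiv
  have hσX : σ • (algebraMap ℚ[X] (RatFunc ℚ) X) = algebraMap ℚ[X] (RatFunc ℚ) (X + C 1) := by
    change σ (algebraMap ℚ[X] (RatFunc ℚ) X) = _
    rw [IsFractionRing.ringEquivOfRingEquiv_algebraMap]
    congr 1
    change aeval (X + C (1 : ℚ)) (X : ℚ[X]) = X + C 1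
    exact aeval_X _
  have hX : v (algebraMap ℚ[X] (RatFunc ℚ) X) < 1 := by
    rw [HeightOneSpectrum.valuation_of_algebraMap, HeightOneSpectrum.intValuation_lt_one_iff_mem, idealX_span]
    exact Ideal.mem_span_singleton_self X
  have hX1 : v (algebraMap ℚ[X] (RatFunc ℚ) (X + C 1)) = 1 := by
    rw [HeightOneSpectrum.valuation_of_algebraMap, HeightOneSpectrum.intValuation_eq_one_iff, idealX_span,
      Ideal.mem_span_singleton]
    intro hdvd
    have h0 := (X_dvd_iff).mp hdvd
    simp at h0
  haveI := h (RatFunc ℚ) _ v (RingAut (RatFunc ℚ))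
  have := IsValPreserving.val_smul (w := v) σ (algebraMap ℚ[X] (RatFunc ℚ) X)
  rw [hσX, hX1] at this
  exact absurd this.symm hX.ne

/-- **F-2630, INHABITED**: `Gal(ℚ̄_2/ℚ_2)` acts on `ℚ̄_2` by isometries (`isValPreserving_padic`, by name).
[cite: LANA2026Report, §3.5 p. 19] -/
theorem exists_isValPreserving :
    ∃ (K : Type) (_ : Field K) (Γ₀ : Type) (_ : LinearOrderedCommGroupWithZero Γ₀) (w : Valuation K Γ₀)
        (G : Type) (_ : Group G) (_ : MulSemiringAction G K), IsValPreserving w G :=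
  ⟨PadicAlgCl 2, inferInstance, _, inferInstance, padicVal 2, PadicGal 2, inferInstance, inferInstance,
    isValPreserving_padic 2⟩

end SchemaClosures

end IUTFork

end Summit.ABC

end
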